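import Summits.QuantumFields.YangMills.Theorems.UnitScaleTiltUnitTiltOfRegularPrinted

/-!
# Route `UnitScaleTilt` — glue item `UnitTiltOfRegPr` (stmt-QuantumFields-19202) of the gen-3 split of crux K1 `UnitTilt`
# (stmt-QuantumFields-18915) over PRINT'S regular space in full: `MinimiserStabilityRegPr → FluctuationComparisonRegPr → UnitTilt`

Cell `ym3-torus` (HUMAN RULING D-0037, YM ladder rung R3), seat `ym3-torus-p1` gen 6.  The glue the resplit R59/R68 generated is, token for
token, the tree theorem `Summit.QuantumFields.YangMills.Theorems.unitScaleTilt_unitTilt_of_regPr` (p416206, seat gen 5; HOME/UV3-NODE.md §12):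
the two children's prefixes `∀ L ∃ ε₁ ∀ ε₀ ≤ ε₁ ∃ m₀ ∀ m ≥ m₀ ∀ b₀ p₀ ∃ γ₁ ∀ F γ …` feed `T3PrintedRegularMinimiser.unitTilt_shape_of_regPr`.
This file only restates that theorem at the route decl's name so the gate can close the glue item; NOT a proof of either child.
-/

namespace Summit.QuantumFields.YangMills.Theorems

/-- **GLUE ITEM stmt-QuantumFields-19202**: `MinimiserStabilityRegPr → FluctuationComparisonRegPr → UnitTilt`, by
`unitScaleTilt_unitTilt_of_regPr`. -/
theorem unitTiltOfRegPr_proof : Summit.QuantumFields.YangMills.Theses.UnitScaleTilt.UnitTiltOfRegPr :=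
  fun h₁ h₂ => unitScaleTilt_unitTilt_of_regPr h₁ h₂

end Summit.QuantumFields.YangMills.Theorems
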